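import Summits.QuantumFields.QCD.Theses.SpectralDefectExtinction
import Summits.QuantumFields.QCD.Theorems.ExtinctionBuildsQCD.Negative.InertiaPencil
import Summits.QuantumFields.QCD.Theorems.ExtinctionBuildsQCD.Negative.ChiralInertia
import Summits.QuantumFields.QCD.Theorems.ExtinctionBuildsQCD.Negative.TightPinsLine
import Literature.MathematicalPhysics.QuantumLattice.OverlapLocality
import Literature.MathematicalPhysics.QuantumLattice.GrassmannIntegralWilsonProofs
import Literature.Barriers.QuantumFields.WilsonDeterminantMassSplitting
import Literature.Probability.LatticeModels.ThermodynamicLimit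
import Literature.MathematicalPhysics.QuantumFieldTheory.QCD

/-!
# Wall block of `Γ₅(D_W − δ)`: norm gap and inertia exactly half, from a hopping-form bound
(sub-goal `wallBlock_gap_and_half_of_hop` of crux stmt-QuantumFields-8967)

Deterministic lemma (G3) of the modular cell–wall template (crux idea `Cruxes/TipPricing/Ideas/modular-cell-wall-template.md`,
lead c2; serves stub `stub_spreadOfCells` of line `hermitian-flow-coarea` r3 for crux `TipPricing`).  From an ABSTRACT bound on
the colour hopping form on a site set `S`, `Σ_μ Re⟨φ, F_μ φ⟩ ≤ K Σ‖φ‖²` for `φ` supported on `S` (supplied by the flux-region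
coercivity `fluxRegion_hopping_form_le` with `K = 4 − 3/8 + 12η`), and `δ + K < 4`:
* `wallGap_re_form_wilsonHop` — the gamma matrices drop out of the real part: `Re⟨ψ, W_μ ψ⟩ = Σ_spin Re⟨ψ_s, F_μ ψ_s⟩`;
* `wallGap_re_form_wilsonDirac_ge` — accretivity `(4 − δ − K)‖ψ‖² ≤ Re⟨ψ, D_W(U,−δ,1) ψ⟩` for spinors supported on `S`;
* `wallGap_norm_gap_of_form` — accretive form ⇒ norm gap (no square roots);
* `wallBlock_gap_and_half_of_hop` — the principal block `A` of `Γ₅ D_W(U,−δ,1)` over the quark indices of `S` has the norm gap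
  `(4 − δ − K)²‖v‖² ≤ ‖A v‖²`, exactly `6·|S|` negative characteristic roots (chiral inertia, tree `countP_neg_eq_of_chiral`), and
  `det A ≠ 0`.
Supports stmt-QuantumFields-8967 (helper; closes no item).
-/

noncomputable section

namespace Summit.QuantumFields.QCD.Cruxes.TipPricing.ModularTemplate

open Matrix
open Literature.MathematicalPhysics.QuantumLattice Literature.MathematicalPhysics.QuantumFieldTheory
  Literature.Probability.LatticeModels
open Summit.QuantumFields.QCD.Theorems.ExtinctionBuildsQCD.Negative
open scoped BigOperators ComplexConjugate Classical Kronecker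

variable {n : ℕ} [NeZero n]

/-! ### Zero extension from a site set -/

omit [NeZero n] in
/-- Zero extension of a vector on the quark indices over `S` to the whole torus. -/
theorem wallGap_ext_apply_mem {S : Set (TorusSite 4 n)} (v : {p : TorusSite 4 n × Fin 3 × Fin 4 // p.1 ∈ S} → ℂ)
    (p : TorusSite 4 n × Fin 3 × Fin 4) (hp : p.1 ∈ S) :
    (fun q : TorusSite 4 n × Fin 3 × Fin 4 => if h : q.1 ∈ S then v ⟨q, h⟩ else 0) p = v ⟨p, hp⟩ := by
  simp [hp]

/-- A sum over all quark indices of a function vanishing off `S` is the sum over the subtype. [folklore] -/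
theorem wallGap_sum_extend {S : Set (TorusSite 4 n)} (f : TorusSite 4 n × Fin 3 × Fin 4 → ℂ)
    (hf : ∀ p, p.1 ∉ S → f p = 0) :
    ∑ p, f p = ∑ q : {p : TorusSite 4 n × Fin 3 × Fin 4 // p.1 ∈ S}, f q := by
  rw [← Fintype.sum_subtype_add_sum_subtype (fun p : TorusSite 4 n × Fin 3 × Fin 4 => p.1 ∈ S) f]
  have h0 : ∑ q : {p : TorusSite 4 n × Fin 3 × Fin 4 // ¬ p.1 ∈ S}, f q = 0 :=
    Finset.sum_eq_zero fun q _ => hf q.1 q.2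
  rw [h0, add_zero]

/-- Real version of `wallGap_sum_extend`. -/
theorem wallGap_sum_extend_real {S : Set (TorusSite 4 n)} (f : TorusSite 4 n × Fin 3 × Fin 4 → ℝ)
    (hf : ∀ p, p.1 ∉ S → f p = 0) :
    ∑ p, f p = ∑ q : {p : TorusSite 4 n × Fin 3 × Fin 4 // p.1 ∈ S}, f q := by
  rw [← Fintype.sum_subtype_add_sum_subtype (fun p : TorusSite 4 n × Fin 3 × Fin 4 => p.1 ∈ S) f]
  have h0 : ∑ q : {p : TorusSite 4 n × Fin 3 × Fin 4 // ¬ p.1 ∈ S}, f q = 0 :=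
    Finset.sum_eq_zero fun q _ => hf q.1 q.2
  rw [h0, add_zero]

/-! ### The real part of the hopping form: the gamma matrices drop out -/

/-- `Re⟨χ, Yᴴ χ⟩ = Re⟨χ, Y χ⟩`. [folklore] -/
theorem wallGap_re_form_conjTranspose {ι : Type*} [Fintype ι] (Y : Matrix ι ι ℂ) (χ : ι → ℂ) :
    (star χ ⬝ᵥ Yᴴ *ᵥ χ).re = (star χ ⬝ᵥ Y *ᵥ χ).re := by
  have : star χ ⬝ᵥ Yᴴ *ᵥ χ = star (star χ ⬝ᵥ Y *ᵥ χ) := by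
    calc star χ ⬝ᵥ Yᴴ *ᵥ χ = star χ ᵥ* Yᴴ ⬝ᵥ χ := dotProduct_mulVec _ _ _
      _ = star (Y *ᵥ χ) ⬝ᵥ χ := by rw [star_mulVec]
      _ = star (Y *ᵥ χ) ⬝ᵥ star (star χ) := by rw [star_star]
      _ = star (star χ ⬝ᵥ Y *ᵥ χ) := star_dotProduct_star _ _
  rw [this, Complex.star_def, Complex.conj_re]

/-- Form of a Kronecker product with the identity on the right: block sum over the second index. [folklore] -/
theorem wallGap_form_kronecker_one {ι κ : Type*} [Fintype ι] [Fintype κ] [DecidableEq κ]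
    (F : Matrix ι ι ℂ) (χ : ι × κ → ℂ) :
    star χ ⬝ᵥ (F ⊗ₖ (1 : Matrix κ κ ℂ)) *ᵥ χ = ∑ s : κ, star (fun i => χ (i, s)) ⬝ᵥ F *ᵥ fun i => χ (i, s) := by
  simp only [dotProduct, mulVec, Matrix.kroneckerMap_apply, Matrix.one_apply, Fintype.sum_prod_type, Pi.star_apply,
    mul_ite, mul_one, mul_zero]
  rw [Finset.sum_comm]
  refine Finset.sum_congr rfl fun s _ => Finset.sum_congr rfl fun i _ => ?_
  congr 1
  refine Finset.sum_congr rfl fun j _ => ?_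
  simp only [ite_mul, zero_mul, Finset.sum_ite_eq, Finset.mem_univ, if_true]

/-- The real part of the Wilson hopping form in direction `μ` is the colour hopping form summed over the spin index:
`Re⟨ψ, W_μ ψ⟩ = Σ_s Re⟨ψ_s, F_μ ψ_s⟩`. [folklore] -/
theorem wallGap_re_form_wilsonHop (U : GaugeConfig 4 n SU3) (μ : Fin 4) (ψ : TorusSite 4 n × Fin 3 × Fin 4 → ℂ) :
    (star ψ ⬝ᵥ wilsonHop (fundamentalRep (Fin 3)) U μ *ᵥ ψ).re =
      ∑ s : Fin 4, (star (fun i : TorusSite 4 n × Fin 3 => ψ (i.1, i.2, s)) ⬝ᵥ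
        linkHop (fundamentalRep (Fin 3)) U μ *ᵥ fun i : TorusSite 4 n × Fin 3 => ψ (i.1, i.2, s)).re := by
  set e := Equiv.prodAssoc (TorusSite 4 n) (Fin 3) (Fin 4) with he
  set χ : (TorusSite 4 n × Fin 3) × Fin 4 → ℂ := ψ ∘ e with hχ
  set F := linkHop (fundamentalRep (Fin 3)) U μ with hF
  have hre : star ψ ⬝ᵥ wilsonHop (fundamentalRep (Fin 3)) U μ *ᵥ ψ =
      star χ ⬝ᵥ (F ⊗ₖ chiralProjMinus μ + Fᴴ ⊗ₖ chiralProjPlus μ) *ᵥ χ := by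
    rw [wilsonHop, Matrix.reindex_apply, hχ, hF]
    rw [show ψ = χ ∘ e.symm from by rw [hχ]; ext p; simp]
    rw [show (χ ∘ ⇑e.symm) ∘ ⇑e = χ from by ext p; simp]
    rw [dotProduct, dotProduct, ← e.symm.sum_comp]
    refine Finset.sum_congr rfl fun a _ => ?_
    simp only [Pi.star_apply, Function.comp_apply, mulVec, dotProduct, Matrix.submatrix_apply]
    congr 1
    rw [← e.symm.sum_comp]
  rw [hre, add_mulVec, dotProduct_add, Complex.add_re]
  have h2 : (star χ ⬝ᵥ (Fᴴ ⊗ₖ chiralProjPlus μ) *ᵥ χ).re = (star χ ⬝ᵥ (F ⊗ₖ chiralProjPlus μ) *ᵥ χ).re := by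
    have : Fᴴ ⊗ₖ chiralProjPlus μ = (F ⊗ₖ chiralProjPlus μ)ᴴ := by
      rw [conjTranspose_kronecker, chiralProjPlus_conjTranspose]
    rw [this, wallGap_re_form_conjTranspose]
  rw [h2, ← Complex.add_re, ← dotProduct_add, ← add_mulVec, ← Matrix.kronecker_add,
    chiralProjMinus_add_chiralProjPlus, wallGap_form_kronecker_one, Complex.re_sum]
  rfl

/-! ### The real part of the Wilson form on a region from a hopping-form bound -/

/-- **Accretivity of `D_W − δ` on region-supported vectors from a bound on the colour hopping form.**  If
`Σ_μ Re⟨φ, F_μ φ⟩ ≤ K Σ‖φ‖²` for every colour vector `φ` supported on `S`, then for every spinor `ψ` supported on `S`,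
`(4 − δ − K) Σ‖ψ‖² ≤ Re⟨ψ, D_W(U, −δ, 1) ψ⟩`. [folklore] -/
theorem wallGap_re_form_wilsonDirac_ge (U : GaugeConfig 4 n SU3) (S : Set (TorusSite 4 n)) (δ K : ℝ)
    (hhop : ∀ φ : TorusSite 4 n × Fin 3 → ℂ, (∀ p, p.1 ∉ S → φ p = 0) →
      ∑ μ : Fin 4, (star φ ⬝ᵥ linkHop (fundamentalRep (Fin 3)) U μ *ᵥ φ).re ≤ K * ∑ p, ‖φ p‖ ^ 2)
    (ψ : TorusSite 4 n × Fin 3 × Fin 4 → ℂ) (hψ : ∀ p, p.1 ∉ S → ψ p = 0) :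
    (4 - δ - K) * ∑ p, ‖ψ p‖ ^ 2 ≤ (star ψ ⬝ᵥ wilsonDirac (fundamentalRep (Fin 3)) U (-δ) 1 *ᵥ ψ).re := by
  have hρ : ∀ g : SU3, fundamentalRep (Fin 3) g ∈ Matrix.unitaryGroup (Fin 3) ℂ := fundamentalRep_mem_unitaryGroup
  have hform : (star ψ ⬝ᵥ wilsonDirac (fundamentalRep (Fin 3)) U (-δ) 1 *ᵥ ψ).re =
      (-δ + 4) * ∑ p, ‖ψ p‖ ^ 2 - ∑ μ, (star ψ ⬝ᵥ wilsonHop (fundamentalRep (Fin 3)) U μ *ᵥ ψ).re := by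
    rw [wilsonDirac_eq_sub_sum_wilsonHop (fundamentalRep (Fin 3)) hρ U (-δ), sub_mulVec, smul_mulVec, one_mulVec,
      sum_mulVec, dotProduct_sub, dotProduct_smul, dotProduct_sum, Complex.sub_re, smul_eq_mul, Complex.re_ofReal_mul,
      Complex.re_sum, re_star_dotProduct_self]
  rw [hform]
  -- the hopping part, spin component by spin component
  have hcomp : ∀ s : Fin 4, ∑ μ : Fin 4, (star (fun i : TorusSite 4 n × Fin 3 => ψ (i.1, i.2, s)) ⬝ᵥ
      linkHop (fundamentalRep (Fin 3)) U μ *ᵥ fun i : TorusSite 4 n × Fin 3 => ψ (i.1, i.2, s)).re ≤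
      K * ∑ i : TorusSite 4 n × Fin 3, ‖ψ (i.1, i.2, s)‖ ^ 2 :=
    fun s => hhop _ fun i hi => hψ (i.1, i.2, s) hi
  have hsum : ∑ μ, (star ψ ⬝ᵥ wilsonHop (fundamentalRep (Fin 3)) U μ *ᵥ ψ).re ≤ K * ∑ p, ‖ψ p‖ ^ 2 := by
    calc ∑ μ, (star ψ ⬝ᵥ wilsonHop (fundamentalRep (Fin 3)) U μ *ᵥ ψ).re
        = ∑ μ, ∑ s : Fin 4, (star (fun i : TorusSite 4 n × Fin 3 => ψ (i.1, i.2, s)) ⬝ᵥ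
            linkHop (fundamentalRep (Fin 3)) U μ *ᵥ fun i : TorusSite 4 n × Fin 3 => ψ (i.1, i.2, s)).re :=
          Finset.sum_congr rfl fun μ _ => wallGap_re_form_wilsonHop U μ ψ
      _ = ∑ s : Fin 4, ∑ μ, (star (fun i : TorusSite 4 n × Fin 3 => ψ (i.1, i.2, s)) ⬝ᵥ
            linkHop (fundamentalRep (Fin 3)) U μ *ᵥ fun i : TorusSite 4 n × Fin 3 => ψ (i.1, i.2, s)).re :=
          Finset.sum_comm
      _ ≤ ∑ s : Fin 4, K * ∑ i : TorusSite 4 n × Fin 3, ‖ψ (i.1, i.2, s)‖ ^ 2 := Finset.sum_le_sum fun s _ => hcomp s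
      _ = K * ∑ p, ‖ψ p‖ ^ 2 := by
          rw [← Finset.mul_sum]
          congr 1
          rw [Finset.sum_comm, Fintype.sum_prod_type, Fintype.sum_prod_type]
          refine Finset.sum_congr rfl fun x _ => ?_
          rw [Fintype.sum_prod_type]
  nlinarith

/-! ### From the form to the block: extension by zero, norm gap, inertia -/

/-- The principal block acts as the full matrix on the zero extension. [folklore] -/
theorem wallGap_submatrix_mulVec_apply {S : Set (TorusSite 4 n)}
    (X : Matrix (TorusSite 4 n × Fin 3 × Fin 4) (TorusSite 4 n × Fin 3 × Fin 4) ℂ)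
    (v : {p : TorusSite 4 n × Fin 3 × Fin 4 // p.1 ∈ S} → ℂ) (i : {p : TorusSite 4 n × Fin 3 × Fin 4 // p.1 ∈ S}) :
    (X.submatrix (Subtype.val : {p : TorusSite 4 n × Fin 3 × Fin 4 // p.1 ∈ S} → _) Subtype.val *ᵥ v) i =
      (X *ᵥ extendByZero (fun q : TorusSite 4 n × Fin 3 × Fin 4 => q.1 ∈ S) v) i.1 := by
  simp only [mulVec, dotProduct, Matrix.submatrix_apply]
  rw [wallGap_sum_extend (S := S) (fun p => X i.1 p * extendByZero (fun q : TorusSite 4 n × Fin 3 × Fin 4 => q.1 ∈ S) v p)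
    (fun p hp => by rw [extendByZero_apply_of_neg v hp, mul_zero])]
  refine Finset.sum_congr rfl fun q _ => ?_
  rw [extendByZero_apply_of_pos v q.2]

/-- The block form is the full form of the zero extension. [folklore] -/
theorem wallGap_form_submatrix {S : Set (TorusSite 4 n)}
    (X : Matrix (TorusSite 4 n × Fin 3 × Fin 4) (TorusSite 4 n × Fin 3 × Fin 4) ℂ)
    (v : {p : TorusSite 4 n × Fin 3 × Fin 4 // p.1 ∈ S} → ℂ) :
    star v ⬝ᵥ X.submatrix (Subtype.val : {p : TorusSite 4 n × Fin 3 × Fin 4 // p.1 ∈ S} → _) Subtype.val *ᵥ v =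
      star (extendByZero (fun q : TorusSite 4 n × Fin 3 × Fin 4 => q.1 ∈ S) v) ⬝ᵥ
        X *ᵥ extendByZero (fun q : TorusSite 4 n × Fin 3 × Fin 4 => q.1 ∈ S) v := by
  rw [dotProduct, dotProduct,
    wallGap_sum_extend (S := S) (fun p => star (extendByZero (fun q : TorusSite 4 n × Fin 3 × Fin 4 => q.1 ∈ S) v) p *
      (X *ᵥ extendByZero (fun q : TorusSite 4 n × Fin 3 × Fin 4 => q.1 ∈ S) v) p)
      (fun p hp => by rw [Pi.star_apply, extendByZero_apply_of_neg v hp, star_zero, zero_mul])]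
  refine Finset.sum_congr rfl fun i _ => ?_
  rw [wallGap_submatrix_mulVec_apply, Pi.star_apply, Pi.star_apply, extendByZero_apply_of_pos v i.2]

/-- `Γ₅` is a diagonal sign: the block of `Γ₅ X` has the same entrywise norms of its action as the block of `X`. [folklore] -/
theorem wallGap_norm_gammaFive_block_apply {S : Set (TorusSite 4 n)}
    (X : Matrix (TorusSite 4 n × Fin 3 × Fin 4) (TorusSite 4 n × Fin 3 × Fin 4) ℂ)
    (v : {p : TorusSite 4 n × Fin 3 × Fin 4 // p.1 ∈ S} → ℂ) (i : {p : TorusSite 4 n × Fin 3 × Fin 4 // p.1 ∈ S}) :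
    ‖((spinorLift gammaFive * X).submatrix (Subtype.val : {p : TorusSite 4 n × Fin 3 × Fin 4 // p.1 ∈ S} → _)
        Subtype.val *ᵥ v) i‖ =
      ‖(X.submatrix (Subtype.val : {p : TorusSite 4 n × Fin 3 × Fin 4 // p.1 ∈ S} → _) Subtype.val *ᵥ v) i‖ := by
  rw [wallGap_submatrix_mulVec_apply, wallGap_submatrix_mulVec_apply, ← mulVec_mulVec, spinorLift_gammaFive_eq_diagonal,
    mulVec_diagonal, norm_mul]
  obtain ⟨⟨x, a, α⟩, hx⟩ := i
  fin_cases α <;> simp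

/-- **Accretive form ⇒ norm gap** (no square roots): if `g Σ‖v‖² ≤ Re⟨v, M v⟩` with `0 ≤ g`, then `g² Σ‖v‖² ≤ Σ‖(M v)‖²`. [folklore] -/
theorem wallGap_norm_gap_of_form {ι : Type*} [Fintype ι] (M : Matrix ι ι ℂ) {g : ℝ} (hg : 0 ≤ g) (v : ι → ℂ)
    (h : g * ∑ i, ‖v i‖ ^ 2 ≤ (star v ⬝ᵥ M *ᵥ v).re) :
    g ^ 2 * ∑ i, ‖v i‖ ^ 2 ≤ ∑ i, ‖(M *ᵥ v) i‖ ^ 2 := by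
  set w := M *ᵥ v with hw
  -- 0 ≤ Σ‖g v_i − w_i‖² = g² Σ‖v‖² − 2g Re⟨v,w⟩ + Σ‖w‖²
  have hexp : ∑ i, ‖(g : ℂ) * v i - w i‖ ^ 2 =
      g ^ 2 * ∑ i, ‖v i‖ ^ 2 - 2 * g * (star v ⬝ᵥ w).re + ∑ i, ‖w i‖ ^ 2 := by
    have hdot : (star v ⬝ᵥ w).re = ∑ i, (star (v i) * w i).re := by rw [dotProduct, Complex.re_sum]; rfl
    rw [hdot, Finset.mul_sum, Finset.mul_sum, ← Finset.sum_sub_distrib, ← Finset.sum_add_distrib]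
    refine Finset.sum_congr rfl fun i _ => ?_
    rw [← Complex.normSq_eq_norm_sq, ← Complex.normSq_eq_norm_sq, ← Complex.normSq_eq_norm_sq, Complex.normSq_sub,
      Complex.normSq_mul, Complex.normSq_ofReal]
    have : ((g : ℂ) * v i * (starRingEnd ℂ) (w i)).re = g * (star (v i) * w i).re := by
      rw [Complex.star_def]
      have h1 : ((g : ℂ) * v i * (starRingEnd ℂ) (w i)) = (g : ℂ) * (v i * (starRingEnd ℂ) (w i)) := by ring
      rw [h1, Complex.re_ofReal_mul]
      congr 1
      rw [← Complex.conj_re (v i * (starRingEnd ℂ) (w i)), map_mul, Complex.conj_conj, mul_comm]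
    rw [this]
    ring
  have h0 : 0 ≤ ∑ i, ‖(g : ℂ) * v i - w i‖ ^ 2 := Finset.sum_nonneg fun i _ => by positivity
  rw [hexp] at h0
  nlinarith [mul_le_mul_of_nonneg_left h hg]

/-- **(G3) from an abstract hopping bound.**  If `Σ_μ Re⟨φ, F_μ φ⟩ ≤ K Σ‖φ‖²` on colour vectors supported on `S` and
`δ + K < 4`, then the principal block `A` of `Γ₅ D_W(U, −δ, 1)` over the quark indices of `S` has the norm gap
`(4 − δ − K)² Σ‖v‖² ≤ Σ‖A v‖²`, exactly `6·|S|` negative characteristic roots, and `det A ≠ 0`. [folklore] -/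
theorem wallBlock_gap_and_half_of_hop (U : GaugeConfig 4 n SU3) (S : Set (TorusSite 4 n)) (δ K : ℝ)
    (hK : δ + K < 4)
    (hhop : ∀ φ : TorusSite 4 n × Fin 3 → ℂ, (∀ p, p.1 ∉ S → φ p = 0) →
      ∑ μ : Fin 4, (star φ ⬝ᵥ linkHop (fundamentalRep (Fin 3)) U μ *ᵥ φ).re ≤ K * ∑ p, ‖φ p‖ ^ 2) :
    (∀ v : {p : TorusSite 4 n × Fin 3 × Fin 4 // p.1 ∈ S} → ℂ,
      (4 - δ - K) ^ 2 * ∑ i, ‖v i‖ ^ 2 ≤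
        ∑ i, ‖(((spinorLift gammaFive * wilsonDirac (fundamentalRep (Fin 3)) U (-δ) 1).submatrix
          (Subtype.val : {p : TorusSite 4 n × Fin 3 × Fin 4 // p.1 ∈ S} → _) Subtype.val) *ᵥ v) i‖ ^ 2) ∧
    negRootCount ((spinorLift gammaFive * wilsonDirac (fundamentalRep (Fin 3)) U (-δ) 1).submatrix
        (Subtype.val : {p : TorusSite 4 n × Fin 3 × Fin 4 // p.1 ∈ S} → _) Subtype.val) =
      6 * Fintype.card {x : TorusSite 4 n // x ∈ S} ∧
    ((spinorLift gammaFive * wilsonDirac (fundamentalRep (Fin 3)) U (-δ) 1).submatrix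
        (Subtype.val : {p : TorusSite 4 n × Fin 3 × Fin 4 // p.1 ∈ S} → _) Subtype.val).det ≠ 0 := by
  set D := wilsonDirac (fundamentalRep (Fin 3)) U (-δ) 1 with hD
  set g₀ : ℝ := 4 - δ - K with hg₀
  have hg₀pos : 0 < g₀ := by rw [hg₀]; linarith
  set Q := {p : TorusSite 4 n × Fin 3 × Fin 4 // p.1 ∈ S}
  set ext := extendByZero (fun q : TorusSite 4 n × Fin 3 × Fin 4 => q.1 ∈ S) with hext
  have hext_supp : ∀ (v : Q → ℂ) (p : TorusSite 4 n × Fin 3 × Fin 4), p.1 ∉ S → ext v p = 0 :=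
    fun v p hp => extendByZero_apply_of_neg v hp
  -- (a) accretivity of the block of `D`
  have hacc : ∀ v : Q → ℂ, g₀ * ∑ i, ‖v i‖ ^ 2 ≤ (star v ⬝ᵥ D.submatrix (Subtype.val : Q → _) (Subtype.val : Q → _) *ᵥ v).re := by
    intro v
    rw [wallGap_form_submatrix, ← sum_norm_sq_extendByZero (fun q : TorusSite 4 n × Fin 3 × Fin 4 => q.1 ∈ S) v]
    exact wallGap_re_form_wilsonDirac_ge U S δ K hhop (ext v) (hext_supp v)
  -- (b) norm gap of the block of `Γ₅ D`
  have hgap : ∀ v : Q → ℂ, g₀ ^ 2 * ∑ i, ‖v i‖ ^ 2 ≤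
      ∑ i, ‖(((spinorLift gammaFive * D).submatrix (Subtype.val : Q → _) (Subtype.val : Q → _)) *ᵥ v) i‖ ^ 2 := by
    intro v
    calc g₀ ^ 2 * ∑ i, ‖v i‖ ^ 2 ≤ ∑ i, ‖(D.submatrix (Subtype.val : Q → _) (Subtype.val : Q → _) *ᵥ v) i‖ ^ 2 :=
          wallGap_norm_gap_of_form _ hg₀pos.le v (hacc v)
      _ = _ := Finset.sum_congr rfl fun i _ => by rw [wallGap_norm_gammaFive_block_apply]
  refine ⟨hgap, ?_, ?_⟩
  · -- (c) inertia exactly half, by chirality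
    have hρ : ∀ g : SU3, fundamentalRep (Fin 3) g ∈ Matrix.unitaryGroup (Fin 3) ℂ := fundamentalRep_mem_unitaryGroup
    have hH : (spinorLift gammaFive * D).IsHermitian :=
      Literature.Barriers.QuantumFields.isHermitian_gammaFive_mul_wilsonDirac (fundamentalRep (Fin 3)) hρ U (-δ) 1
    have hA : ((spinorLift gammaFive * D).submatrix (Subtype.val : Q → _) Subtype.val).IsHermitian :=
      hH.submatrix _
    -- chirality sectors of `Q`
    let Pp : Q → Prop := fun i => (i.1.2.2 : ℕ) < 2
    let Ep := extendByZero Pp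
    let Em := extendByZero (fun i : Q => ¬ Pp i)
    -- the form of `A` on an extension equals the Wilson form up to the chirality sign
    have hformA : ∀ u : Q → ℂ, star u ⬝ᵥ ((spinorLift gammaFive * D).submatrix (Subtype.val : Q → _) (Subtype.val : Q → _) *ᵥ u) =
        star (ext u) ⬝ᵥ ((spinorLift gammaFive * D) *ᵥ ext u) := fun u => wallGap_form_submatrix _ u
    have hpos : ∀ c : {i : Q // Pp i} → ℂ, c ≠ 0 →
        0 < (star (Ep c) ⬝ᵥ (((spinorLift gammaFive * D).submatrix (Subtype.val : Q → _) (Subtype.val : Q → _)) *ᵥ Ep c)).re := by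
      intro c hc
      have hchir : spinorLift (L := n) (N := 3) gammaFive *ᵥ ext (Ep c) = (1 : ℂ) • ext (Ep c) := by
        rw [one_smul]
        funext p
        rw [spinorLift_gammaFive_eq_diagonal, mulVec_diagonal]
        by_cases hp : p.1 ∈ S
        · rw [show ext (Ep c) p = Ep c ⟨p, hp⟩ from
            extendByZero_apply_of_pos (p := fun q : TorusSite 4 n × Fin 3 × Fin 4 => q.1 ∈ S) (Ep c) (i := p) hp]
          by_cases hq : Pp ⟨p, hp⟩
          · obtain ⟨x, a, α⟩ := p
            have hα : (α : ℕ) < 2 := hq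
            fin_cases α <;> simp at hα ⊢
          · rw [show Ep c ⟨p, hp⟩ = 0 from extendByZero_apply_of_neg c hq, mul_zero]
        · rw [hext_supp _ p hp, mul_zero]
      rw [hformA, form_gammaFive_mul_of_chiral D (ext (Ep c)) 1 hchir, map_one, one_mul,
        ← wallGap_form_submatrix]
      have hne : Ep c ≠ 0 := extendByZero_ne_zero hc
      have hpos' : 0 < ∑ i, ‖Ep c i‖ ^ 2 := sum_norm_sq_pos hne
      have := hacc (Ep c)
      nlinarith
    have hneg : ∀ c : {i : Q // ¬ Pp i} → ℂ, c ≠ 0 →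
        (star (Em c) ⬝ᵥ (((spinorLift gammaFive * D).submatrix (Subtype.val : Q → _) (Subtype.val : Q → _)) *ᵥ Em c)).re < 0 := by
      intro c hc
      have hchir : spinorLift (L := n) (N := 3) gammaFive *ᵥ ext (Em c) = (-1 : ℂ) • ext (Em c) := by
        funext p
        rw [spinorLift_gammaFive_eq_diagonal, mulVec_diagonal, Pi.smul_apply, smul_eq_mul]
        by_cases hp : p.1 ∈ S
        · rw [show ext (Em c) p = Em c ⟨p, hp⟩ from
            extendByZero_apply_of_pos (p := fun q : TorusSite 4 n × Fin 3 × Fin 4 => q.1 ∈ S) (Em c) (i := p) hp]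
          by_cases hq : Pp ⟨p, hp⟩
          · rw [show Em c ⟨p, hp⟩ = 0 from extendByZero_apply_of_neg c (not_not.mpr hq), mul_zero, mul_zero]
          · obtain ⟨x, a, α⟩ := p
            have hα : ¬ (α : ℕ) < 2 := hq
            fin_cases α <;> simp at hα ⊢
        · rw [hext_supp _ p hp, mul_zero, mul_zero]
      rw [hformA, form_gammaFive_mul_of_chiral D (ext (Em c)) (-1) hchir, map_neg, map_one, neg_one_mul,
        ← wallGap_form_submatrix, Complex.neg_re]
      have hne : Em c ≠ 0 := extendByZero_ne_zero hc
      have hpos' : 0 < ∑ i, ‖Em c i‖ ^ 2 := sum_norm_sq_pos hne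
      have := hacc (Em c)
      nlinarith
    have hcard : Fintype.card {i : Q // Pp i} + Fintype.card {i : Q // ¬ Pp i} = Fintype.card Q := by
      rw [Fintype.card_subtype_compl, Nat.add_sub_cancel' (Fintype.card_subtype_le _)]
    have hcount := countP_neg_eq_of_chiral hA Ep Em hpos hneg hcard
    rw [negRootCount, hcount]
    -- `card {i : Q // ¬ Pp i} = 6 |S|`
    let eqv : {i : Q // ¬ Pp i} ≃ ({x : TorusSite 4 n // x ∈ S} × Fin 3) × {α : Fin 4 // ¬ (α : ℕ) < 2} :=
      { toFun := fun i => ((⟨i.1.1.1, i.1.2⟩, i.1.1.2.1), ⟨i.1.1.2.2, i.2⟩)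
        invFun := fun y => ⟨⟨(y.1.1.1, y.1.2, y.2.1), y.1.1.2⟩, y.2.2⟩
        left_inv := fun i => rfl
        right_inv := fun y => rfl }
    have h2 : Fintype.card {α : Fin 4 // ¬ (α : ℕ) < 2} = 2 := by decide
    rw [Fintype.card_congr eqv, Fintype.card_prod, Fintype.card_prod, Fintype.card_fin, h2]
    ring
  · -- (d) invertibility from the gap
    rw [Ne, ← Matrix.exists_mulVec_eq_zero_iff]
    rintro ⟨x, hx, hAx⟩
    have h1 := hgap x
    have h2 : ∑ i, ‖(((spinorLift gammaFive * D).submatrix (Subtype.val : Q → _) (Subtype.val : Q → _)) *ᵥ x) i‖ ^ 2 = 0 := by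
      rw [hAx]; simp
    have h3 : 0 < ∑ i, ‖x i‖ ^ 2 := sum_norm_sq_pos hx
    rw [h2] at h1
    nlinarith [pow_pos hg₀pos 2]

end Summit.QuantumFields.QCD.Cruxes.TipPricing.ModularTemplate

end
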